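import Summits.ValiantsHypothesis.ValiantsHypothesis.Theorems.KPlusLogSqLawTropicalBNewtonPolygon
import Summits.ValiantsHypothesis.ValiantsHypothesis.Theorems.KPlusLogSqLawTropicalBGaugeSymmetry

/-!
# Route «KPlusLogSqLaw», crux `TropicalB` (stmt-ValiantsHypothesis-19771) — the Newton-polygon size laws MODULO GAUGE
# (row/column potentials and the time shift `v ↦ v + t·d`)

HONEST FRAMING.  Helper lemmas toward the registered stub `stub_tropThin` of `Cruxes/TropicalB/Lines/birth.lean` (crux
`Summit.ValiantsHypothesis.ValiantsHypothesis.Theses.KPlusLogSqLaw.TropicalB`, item `stmt-ValiantsHypothesis-19771`, route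
`KPlusLogSqLaw`, DRAFT; cell `pub-symmetroid`, seat val-sym-trop-p1 g2).  Companion of `KPlusLogSqLawTropicalBNewtonPolygon.lean`
(`NewtonPolygon.chain_le_valSpread`, `chain_cube_le`, `logSqLaw_of_boundedVal`): those `K`-free laws bound a dominant chain by the
SPREAD of the valuations, which is not an invariant of the chain — the chain (and every dominance statement) is unchanged by
(a) the assignment GAUGE `v a b l ↦ v a b l + F a + G b` (class-independent row/column potentials; `isDominant_addPotential_iff`,
file `KPlusLogSqLawTropicalBGaugeSymmetry`, seat val-sym-trop-p3) and (b) the TIME SHIFT `v a b l ↦ v a b l + t·d l`, which moves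
every dominance slope by `t` (`NewtonPolygon.isDominant_timeShift_iff`, here).  So the laws hold with the valuation spread of ANY
gauge-and-time-shifted copy of `v`:

* `NewtonPolygon.chain_le_valSpread_gauge` — if `V₀ ≤ v a b l + F a + G b + t·d l ≤ V₁` for all `a b l` then `n ≤ 2m(V₁ − V₀) + 1`;
* `NewtonPolygon.chain_cube_le_gauge` — Jarník's law with the same gauged valuation spread (the exponent spread is gauge-free);
* `NewtonPolygon.logSqLaw_of_boundedVal_gauge` — if some gauged copy has `|·| ≤ 2^{c⌊log₂ m⌋²}` then `n ≤ 2^{(c+1)⌊log₂ m⌋² + 3}`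
  (every `K`).

READING.  A thin-window counterexample must have valuations that stay super-quasi-polynomially spread under EVERY row/column
potential and time shift — e.g. the class-DEPENDENT part of the valuation table must be large (SHIFT-THREE's column price `2(b+1)`
on class `1` only is of this kind; its penalty `pen(a − b)` is not a potential either).  [folklore: LP gauge of the assignment problem]
Nothing here bears on `TropicalB` / `KPlusLogSqLaw` in the window, on `Lifting`, DoorA26 / DoorA34, `MatrixDescartes`
(`stmt-ValiantsHypothesis-18050`) or VP ≠ VNP.
-/

-- `Summit.ValiantsHypothesis.ValiantsHypothesis.…` repeats a component by the D-0017 layout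
-- (single-conjunct summit), which the `dupNamespace` linter flags; the name is mandated.
set_option linter.dupNamespace false
set_option autoImplicit false

namespace Summit.ValiantsHypothesis.ValiantsHypothesis.Theorems.KPlusLogSqLaw

open Summit.ValiantsHypothesis.ValiantsHypothesis.Theorems.MatrixDescartes.Negative
open scoped BigOperators
open Finset

namespace NewtonPolygon

variable {m K : ℕ} (d : Fin K → ℕ) (v ε : Fin m → Fin m → Fin K → ℤ)

/-- **Time shift of the weight**: adding `t·d l` to every valuation of class `l` turns the weight at slope `θ` into the old weight
at slope `θ − t`. [folklore] -/
theorem tropWeight_timeShift (t θ : ℤ) (q : Equiv.Perm (Fin m) × (Fin m → Fin K)) :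
    tropWeight d (fun a b l => v a b l + t * d l) θ q = tropWeight d v (θ - t) q := by
  unfold tropWeight
  simp only [sum_add_distrib, ← mul_sum]
  ring

/-- **Dominance is invariant under the time shift** (at the shifted slope). [folklore] -/
theorem isDominant_timeShift_iff (t θ : ℤ) (q : Equiv.Perm (Fin m) × (Fin m → Fin K)) :
    IsDominant d (fun a b l => v a b l + t * d l) ε θ q ↔ IsDominant d v ε (θ - t) q := by
  unfold IsDominant
  simp only [tropWeight_timeShift]

/-- Dominance is invariant under gauge + time shift: `v ↦ v + F a + G b + t·d l`, slope `θ ↦ θ + t`. [folklore] -/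
theorem isDominant_gauge_iff (F G : Fin m → ℤ) (t θ : ℤ) (q : Equiv.Perm (Fin m) × (Fin m → Fin K)) :
    IsDominant d (fun a b l => v a b l + F a + G b + t * d l) ε (θ + t) q ↔ IsDominant d v ε θ q := by
  have h1 := isDominant_timeShift_iff d (fun a b l => v a b l + F a + G b) ε t (θ + t) q
  have h2 := isDominant_addPotential_iff d v ε F G θ q
  rw [add_sub_cancel_right] at h1
  exact h1.trans h2

/-- **Valuation-spread law modulo gauge** (`K`-free): if SOME gauge-and-time-shifted copy `v a b l + F a + G b + t·d l` of the
valuation table lies in `[V₀, V₁]`, a chain of pairwise-consecutive-distinct dominant terms has at most `2m(V₁ − V₀) + 1` steps.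
[folklore] -/
theorem chain_le_valSpread_gauge (F G : Fin m → ℤ) (t V₀ V₁ : ℤ)
    (hv : ∀ a b l, V₀ ≤ v a b l + F a + G b + t * d l ∧ v a b l + F a + G b + t * d l ≤ V₁) {n : ℕ}
    (θ : Fin (n + 1) → ℤ) (p : Fin (n + 1) → Equiv.Perm (Fin m) × (Fin m → Fin K)) (hθ : StrictMono θ)
    (hdom : ∀ k, IsDominant d v ε (θ k) (p k)) (hne : ∀ k : Fin n, p k.castSucc ≠ p k.succ) :
    (n : ℤ) ≤ 2 * m * (V₁ - V₀) + 1 :=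
  chain_le_valSpread d (fun a b l => v a b l + F a + G b + t * d l) ε V₀ V₁ hv (fun k => θ k + t) p
    (fun _ _ h => by simpa using hθ h) (fun k => (isDominant_gauge_iff d v ε F G t (θ k) (p k)).2 (hdom k)) hne

/-- **Jarník's two-thirds law modulo gauge** (`K`-free): with exponents in `[D₀, D₁]` and some gauged copy of the valuations in
`[V₀, V₁]`, `n³ ≤ 24·(m(D₁ − D₀) + 2m(V₁ − V₀))²`. [folklore: Jarník 1926] -/
theorem chain_cube_le_gauge (D₀ D₁ : ℕ) (hd : ∀ l, D₀ ≤ d l ∧ d l ≤ D₁) (F G : Fin m → ℤ) (t V₀ V₁ : ℤ)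
    (hv : ∀ a b l, V₀ ≤ v a b l + F a + G b + t * d l ∧ v a b l + F a + G b + t * d l ≤ V₁) {n : ℕ}
    (θ : Fin (n + 1) → ℤ) (p : Fin (n + 1) → Equiv.Perm (Fin m) × (Fin m → Fin K)) (hθ : StrictMono θ)
    (hdom : ∀ k, IsDominant d v ε (θ k) (p k)) (hne : ∀ k : Fin n, p k.castSucc ≠ p k.succ) :
    (n : ℤ) ^ 3 ≤ 24 * ((m : ℤ) * ((D₁ : ℤ) - D₀) + 2 * m * (V₁ - V₀)) ^ 2 :=
  chain_cube_le d (fun a b l => v a b l + F a + G b + t * d l) ε D₀ D₁ hd V₀ V₁ hv (fun k => θ k + t) p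
    (fun _ _ h => by simpa using hθ h) (fun k => (isDominant_gauge_iff d v ε F G t (θ k) (p k)).2 (hdom k)) hne

/-- **The `log² m` law on gauge-bounded designs, for every `K`**: if some gauge-and-time-shifted copy of the valuation table has all
entries of absolute value `≤ 2^{c⌊log₂ m⌋²}`, every sign-alternating chain of dominant terms has `n ≤ 2^{(c+1)⌊log₂ m⌋² + 3}`.
[folklore] -/
theorem logSqLaw_of_boundedVal_gauge (c : ℕ) (F G : Fin m → ℤ) (t : ℤ)
    (hv : ∀ a b l, (v a b l + F a + G b + t * d l).natAbs ≤ 2 ^ (c * Nat.log 2 m ^ 2)) {n : ℕ}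
    (θ : Fin (n + 1) → ℤ) (p : Fin (n + 1) → Equiv.Perm (Fin m) × (Fin m → Fin K)) (hθ : StrictMono θ)
    (hdom : ∀ k, IsDominant d v ε (θ k) (p k))
    (halt : ∀ k : Fin n, termSign ε (p k.castSucc) * termSign ε (p k.succ) < 0) :
    n ≤ 2 ^ ((c + 1) * Nat.log 2 m ^ 2 + 3) :=
  logSqLaw_of_boundedVal d (fun a b l => v a b l + F a + G b + t * d l) ε c hv (fun k => θ k + t) p
    (fun _ _ h => by simpa using hθ h) (fun k => (isDominant_gauge_iff d v ε F G t (θ k) (p k)).2 (hdom k)) halt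

end NewtonPolygon

end Summit.ValiantsHypothesis.ValiantsHypothesis.Theorems.KPlusLogSqLaw
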